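import Summits.BirchSwinnertonDyer.BirchSwinnertonDyer.Theses.CumulativeHeegnerLeopoldt
import Summits.BirchSwinnertonDyer.BirchSwinnertonDyer.Theorems.CumulativeHeegnerLeopoldtTemperedHeegnerInclusionAtThreeLocalTypeSplit
import Summits.BirchSwinnertonDyer.BirchSwinnertonDyer.Theorems.CumulativeHeegnerLeopoldtTemperedHeegnerInclusionAtThreeLocalTypeSplitDoors
import HarnessLib

/-!
# SKETCH v2 (UNREGISTERED) — line «untwist» for crux A stmt-BirchSwinnertonDyer-26896 `TemperedHeegnerInclusionAtThree`
# (route `CumulativeHeegnerLeopoldt` rev 6; A = stub A of K1 stmt-24198, line birth v5 59217cca)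

Width seat bsd-line-chl-k1-p1-w5 g0. NOT a skeleton of record: this seat's unit does not name crux 26896, so nothing is
registered here (`ledger skeleton check --crux …-26896` / `crux write` on 26896 belong to its crux-plan / lead seats). It is the
ready-to-adopt form asked for by the CHL pen (STATUS 16:39:05Z: «a crux-plan seat registers Lines/<slug>.lean on 26896 with
stub_A_PS := A's text + binder TypeGNine W VERBATIM and `TemperedHeegnerInclusionAtThree_of` through p648533»); v2 follows that word
EXACTLY (v1 used the stronger tempered-index-bound format IB♮|(G₉) as the PS stub; IB♮ ⟹ A is one-way, so v1's stub could be
stronger than the crux requires — v2 registers A|(G₉) itself and keeps IB♮|(G₉) / (LT)|(G₉) as the available INNER DOORS, p650994):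

* `stub_temperedInclusionPS` (RESEARCH; the untwist road of memo `UNTWIST-LINE-SPEC-w5g0.md` §4): A's text VERBATIM with the one
  extra binder `TypeGNine W` after `ClassO6 W 3` — the principal-series rows, where the Atkin–Li untwist g = f_E ⊗ η̄ has U₃-slope ½
  and is crystabelline at 3. Inner doors BY NAME for whoever proves it: IB♮|(G₉) → this stub
  (`TemperedHeegnerInclusionAtThreeLocalTypeSplitDoors.temperedHeegnerInclusionAtThree_typeGNine_of_temperedIndexBound`) and
  (LT)|(G₉) → this stub (`…_typeGNine_of_fittingLayerTower`); inner road (memo §4, not stubs here): untwist dictionary [port] →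
  temper-½ class for g [research «R-wild-pt»] → reciprocity on the α_g-line to A's OWN L [port/research] → reducible KS bound in
  Λ[1/3] [research «R-KS»] → IB♮|(G₉) or (LT)|(G₉).
* `stub_temperedInclusionSC` (RESIDUAL by design): A's text VERBATIM with the binder `¬ TypeGNine W` — supercuspidal and dicyclic
  rows, where no abelian twist has finite slope (birth line's objects, or nothing).
* `TemperedHeegnerInclusionAtThree_of` : the crux BY NAME from the two stubs through the landed local-type split
  `TemperedHeegnerInclusionAtThreeLocalTypeSplit.temperedHeegnerInclusionAtThree_of_localTypeSplit` (p648533).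
* `temperedInclusionPS_of_temperedIndexBound` : kernel check that the inner door composes (IB♮|(G₉) ⟹ stub PS's statement), no sorry.

Sorries ONLY in the two `stub_*`; the composition is kernel-checked. BSD is not proved by any of this; A and K1 stay OPEN.
-/

set_option linter.dupNamespace false
set_option autoImplicit false

noncomputable section

open scoped Classical Polynomial

namespace Summit.BirchSwinnertonDyer.BirchSwinnertonDyer.Cruxes.TemperedHeegnerInclusionAtThree.Untwist

open Literature.NumberTheory.EllipticCurves NumberField IsDedekindDomain Field
  Summit.BirchSwinnertonDyer.Rank1Residual.X11b Summit.BirchSwinnertonDyer.Rank1Residual.X11b.AcSelmer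

/-- STUB PS (RESEARCH, load-bearing): crux A's text VERBATIM on the principal-series rows (extra binder `TypeGNine W`). The
untwist road (memo UNTWIST-LINE-SPEC-w5g0 §4) ends in IB♮|(G₉) or (LT)|(G₉), either of which gives this stub by p650994. -/
theorem stub_temperedInclusionPS :
    ∀ (W : WeierstrassCurve ℚ) [W.IsElliptic] [W.IsGloballyMinimal] (N : ℕ) [NeZero N] (K : Type) [Field K] [NumberField K] (Dt : Literature.NumberTheory.EllipticCurves.ModularForms.ModularParametrizationData W N), Summit.BirchSwinnertonDyer.Rank1Residual.Additive.ClassO6 W 3 → Summit.BirchSwinnertonDyer.Rank1Residual.Additive.TypeGNine W → Literature.NumberTheory.EllipticCurves.Rank1Residual.Red W 3 → (∃ Φ : AddSubgroup (WeierstrassCurve.geomTorsion W ((3 : ℕ) : ℤ)), Literature.NumberTheory.EllipticCurves.Rank1Residual.IsRationalLine W 3 Φ ∧ ∀ (v : IsDedekindDomain.HeightOneSpectrum (NumberField.RingOfIntegers ℚ)), ((3 : ℕ) : NumberField.RingOfIntegers ℚ) ∈ v.asIdeal → ∀ 𝔓 ∈ v.primesAbove, ¬ (∀ g ∈ 𝔓.decompositionSubgroup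 (Field.absoluteGaloisGroup ℚ), ∀ P ∈ Φ, g • P = P) ∧ ¬ (∀ g ∈ 𝔓.decompositionSubgroup (Field.absoluteGaloisGroup ℚ), ∀ P : WeierstrassCurve.geomTorsion W ((3 : ℕ) : ℤ), g • P - P ∈ Φ)) → W.analyticRank = 1 → W.conductorNorm ℤ = N → Literature.NumberTheory.EllipticCurves.IsImaginaryQuadratic K → Literature.NumberTheory.EllipticCurves.SatisfiesHeegnerHypothesis N K → ∀ (κ : Literature.NumberTheory.EllipticCurves.ZpExtension K 3), κ.IsAnticyclotomic → ∀ (γ : Field.absoluteGaloisGroup K) [Fact (κ.IsTopGenerator γ)] (𝔭 : IsDedekindDomain.HeightOneSpectrum (NumberField.RingOfIntegers K)), ((3 : ℕ) : NumberField.RingOfIntegers K) ∈ 𝔭.asIdeal → 𝔭.asIdeal.ramificationIdx (NumberField.RingOfIntegers ℚ) = 1 → 𝔭.asIdeal.inertiaDeg (NumberField.RingOfIntegers ℚ) = 1 → ∀ (𝔭' : IsDedekindDomain.HeightOneSpectrum (NumberField.RingOfIntegers K)), ((3 : ℕ) : NumberField.RingOfIntegers K) ∈ 𝔭'.asIdeal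 → 𝔭' ≠ 𝔭 → ∀ (ι' : PadicAlgCl 3 ≃+* ℂ), Summit.BirchSwinnertonDyer.BirchSwinnertonDyer.Theorems.SchneiderFree.BranchInducesPrime 3 ι' 𝔭 → ∀ (ΩK : ℂ) (Ωp : ℂ_[3]) (L : Literature.NumberTheory.EllipticCurves.UnrSeries 3), ΩK ≠ 0 → Ωp ≠ 0 → Literature.NumberTheory.EllipticCurves.IsBDPLFunction ι' 𝔭 κ γ Dt.f ΩK Ωp L → ∃ μ : ℕ, Ideal.span {(3 : Literature.NumberTheory.EllipticCurves.UnrSeries 3) ^ μ * L} ≤ (Summit.BirchSwinnertonDyer.Rank1Residual.X11b.AcSelmer.XAc.charIdeal (W.baseChange K) 3 κ 𝔭' ∅ γ).map (PowerSeries.map (Summit.BirchSwinnertonDyer.Rank1Residual.X11b.Halves.toUnr 3)) := by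
  sorry

/-- STUB SC (RESIDUAL by design): crux A's text VERBATIM on the rows that are NOT principal series (`¬ TypeGNine W`): Φ = C₃/C₆ with
Frobenius-inverted inertia character (supercuspidal) or Φ dicyclic of order 12 — no finite-slope untwist exists there. -/
theorem stub_temperedInclusionSC :
    ∀ (W : WeierstrassCurve ℚ) [W.IsElliptic] [W.IsGloballyMinimal] (N : ℕ) [NeZero N] (K : Type) [Field K] [NumberField K] (Dt : Literature.NumberTheory.EllipticCurves.ModularForms.ModularParametrizationData W N), Summit.BirchSwinnertonDyer.Rank1Residual.Additive.ClassO6 W 3 → ¬ Summit.BirchSwinnertonDyer.Rank1Residual.Additive.TypeGNine W → Literature.NumberTheory.EllipticCurves.Rank1Residual.Red W 3 → (∃ Φ : AddSubgroup (WeierstrassCurve.geomTorsion W ((3 : ℕ) : ℤ)), Literature.NumberTheory.EllipticCurves.Rank1Residual.IsRationalLine W 3 Φ ∧ ∀ (v : IsDedekindDomain.HeightOneSpectrum (NumberField.RingOfIntegers ℚ)), ((3 : ℕ) : NumberField.RingOfIntegers ℚ) ∈ v.asIdeal → ∀ 𝔓 ∈ v.primesAbove, ¬ (∀ g ∈ 𝔓.decompositionSubgroup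 (Field.absoluteGaloisGroup ℚ), ∀ P ∈ Φ, g • P = P) ∧ ¬ (∀ g ∈ 𝔓.decompositionSubgroup (Field.absoluteGaloisGroup ℚ), ∀ P : WeierstrassCurve.geomTorsion W ((3 : ℕ) : ℤ), g • P - P ∈ Φ)) → W.analyticRank = 1 → W.conductorNorm ℤ = N → Literature.NumberTheory.EllipticCurves.IsImaginaryQuadratic K → Literature.NumberTheory.EllipticCurves.SatisfiesHeegnerHypothesis N K → ∀ (κ : Literature.NumberTheory.EllipticCurves.ZpExtension K 3), κ.IsAnticyclotomic → ∀ (γ : Field.absoluteGaloisGroup K) [Fact (κ.IsTopGenerator γ)] (𝔭 : IsDedekindDomain.HeightOneSpectrum (NumberField.RingOfIntegers K)), ((3 : ℕ) : NumberField.RingOfIntegers K) ∈ 𝔭.asIdeal → 𝔭.asIdeal.ramificationIdx (NumberField.RingOfIntegers ℚ) = 1 → 𝔭.asIdeal.inertiaDeg (NumberField.RingOfIntegers ℚ) = 1 → ∀ (𝔭' : IsDedekindDomain.HeightOneSpectrum (NumberField.RingOfIntegers K)), ((3 : ℕ) : NumberField.RingOfIntegers K) ∈ 𝔭'.asIdeal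 → 𝔭' ≠ 𝔭 → ∀ (ι' : PadicAlgCl 3 ≃+* ℂ), Summit.BirchSwinnertonDyer.BirchSwinnertonDyer.Theorems.SchneiderFree.BranchInducesPrime 3 ι' 𝔭 → ∀ (ΩK : ℂ) (Ωp : ℂ_[3]) (L : Literature.NumberTheory.EllipticCurves.UnrSeries 3), ΩK ≠ 0 → Ωp ≠ 0 → Literature.NumberTheory.EllipticCurves.IsBDPLFunction ι' 𝔭 κ γ Dt.f ΩK Ωp L → ∃ μ : ℕ, Ideal.span {(3 : Literature.NumberTheory.EllipticCurves.UnrSeries 3) ^ μ * L} ≤ (Summit.BirchSwinnertonDyer.Rank1Residual.X11b.AcSelmer.XAc.charIdeal (W.baseChange K) 3 κ 𝔭' ∅ γ).map (PowerSeries.map (Summit.BirchSwinnertonDyer.Rank1Residual.X11b.Halves.toUnr 3)) := by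
  sorry

/-- COMPOSITION (kernel-checked): STUB PS → STUB SC ⟹ the route crux `TemperedHeegnerInclusionAtThree` BY NAME, through the landed
local-type split p648533. -/
theorem TemperedHeegnerInclusionAtThree_of :
    Summit.BirchSwinnertonDyer.BirchSwinnertonDyer.Theses.CumulativeHeegnerLeopoldt.TemperedHeegnerInclusionAtThree :=
  Summit.BirchSwinnertonDyer.BirchSwinnertonDyer.Theorems.TemperedHeegnerInclusionAtThreeLocalTypeSplit.temperedHeegnerInclusionAtThree_of_localTypeSplit
    stub_temperedInclusionPS stub_temperedInclusionSC

/-- INNER DOOR CHECK (no sorry of its own): the tempered index bound on the principal-series rows (IB♮|(G₉), displayed hypothesis)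
gives STUB PS's statement, by the landed restricted door p650994 — so a worker may prove STUB PS in IB♮ currency. -/
theorem temperedInclusionPS_of_temperedIndexBound
    (hIB : ∀ (W : WeierstrassCurve ℚ) [W.IsElliptic] [W.IsGloballyMinimal] (N : ℕ) [NeZero N] (K : Type) [Field K] [NumberField K] (Dt : Literature.NumberTheory.EllipticCurves.ModularForms.ModularParametrizationData W N), Summit.BirchSwinnertonDyer.Rank1Residual.Additive.ClassO6 W 3 → Summit.BirchSwinnertonDyer.Rank1Residual.Additive.TypeGNine W → Literature.NumberTheory.EllipticCurves.Rank1Residual.Red W 3 → (∃ Φ : AddSubgroup (WeierstrassCurve.geomTorsion W ((3 : ℕ) : ℤ)), Literature.NumberTheory.EllipticCurves.Rank1Residual.IsRationalLine W 3 Φ ∧ ∀ (v : IsDedekindDomain.HeightOneSpectrum (NumberField.RingOfIntegers ℚ)), ((3 : ℕ) : NumberField.RingOfIntegers ℚ) ∈ v.asIdeal → ∀ 𝔓 ∈ v.primesAbove, ¬ (∀ g ∈ 𝔓.decompositionSubgroup (Field.absoluteGaloisGroup ℚ), ∀ P ∈ Φ, g • P = P) ∧ ¬ (∀ g ∈ 𝔓.decompositionSubgroup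 (Field.absoluteGaloisGroup ℚ), ∀ P : WeierstrassCurve.geomTorsion W ((3 : ℕ) : ℤ), g • P - P ∈ Φ)) → W.analyticRank = 1 → W.conductorNorm ℤ = N → Literature.NumberTheory.EllipticCurves.IsImaginaryQuadratic K → Literature.NumberTheory.EllipticCurves.SatisfiesHeegnerHypothesis N K → ∀ (κ : Literature.NumberTheory.EllipticCurves.ZpExtension K 3), κ.IsAnticyclotomic → ∀ (γ : Field.absoluteGaloisGroup K) [Fact (κ.IsTopGenerator γ)] (𝔭 : IsDedekindDomain.HeightOneSpectrum (NumberField.RingOfIntegers K)), ((3 : ℕ) : NumberField.RingOfIntegers K) ∈ 𝔭.asIdeal → 𝔭.asIdeal.ramificationIdx (NumberField.RingOfIntegers ℚ) = 1 → 𝔭.asIdeal.inertiaDeg (NumberField.RingOfIntegers ℚ) = 1 → ∀ (𝔭' : IsDedekindDomain.HeightOneSpectrum (NumberField.RingOfIntegers K)), ((3 : ℕ) : NumberField.RingOfIntegers K) ∈ 𝔭'.asIdeal → 𝔭' ≠ 𝔭 → ∀ (ι' : PadicAlgCl 3 ≃+* ℂ), Summit.BirchSwinnertonDyer.BirchSwinnertonDyer.Theorems.SchneiderFree.BranchInducesPrime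 3 ι' 𝔭 → ∀ (ΩK : ℂ) (Ωp : ℂ_[3]) (L : Literature.NumberTheory.EllipticCurves.UnrSeries 3), ΩK ≠ 0 → Ωp ≠ 0 → Literature.NumberTheory.EllipticCurves.IsBDPLFunction ι' 𝔭 κ γ Dt.f ΩK Ωp L → ∀ ρ : ℝ, ρ < 1 → ∃ (C : ℕ) (a : IwasawaAlgebra 3), a ≠ 0 ∧ ∀ Q : ℤ_[3][X], Q.IsDistinguishedAt (IsLocalRing.maximalIdeal ℤ_[3]) → Irreducible Q → IsRelPrime a (Q : IwasawaAlgebra 3) → ∀ y : PadicAlgCl 3, Polynomial.aeval y (Q.map (algebraMap ℤ_[3] ℚ_[3])) = 0 → ‖(y : ℂ_[3])‖ ≤ ρ → ∀ v : ℂ_[3], L.HasValueAt (y : ℂ_[3]) v → (Nat.card (Summit.BirchSwinnertonDyer.Rank1Residual.X11b.AcSelmer.XAc (W.baseChange K) 3 κ 𝔭' ∅ γ ⧸ (Ideal.span {(Q : IwasawaAlgebra 3)} • ⊤ : Submodule (IwasawaAlgebra 3) (Summit.BirchSwinnertonDyer.Rank1Residual.X11b.AcSelmer.XAc (W.baseChange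 K) 3 κ 𝔭' ∅ γ))) : ℝ) * ‖v‖ ^ Q.natDegree ≤ (3 : ℝ) ^ (C * Q.natDegree)) :
    ∀ (W : WeierstrassCurve ℚ) [W.IsElliptic] [W.IsGloballyMinimal] (N : ℕ) [NeZero N] (K : Type) [Field K] [NumberField K] (Dt : Literature.NumberTheory.EllipticCurves.ModularForms.ModularParametrizationData W N), Summit.BirchSwinnertonDyer.Rank1Residual.Additive.ClassO6 W 3 → Summit.BirchSwinnertonDyer.Rank1Residual.Additive.TypeGNine W → Literature.NumberTheory.EllipticCurves.Rank1Residual.Red W 3 → (∃ Φ : AddSubgroup (WeierstrassCurve.geomTorsion W ((3 : ℕ) : ℤ)), Literature.NumberTheory.EllipticCurves.Rank1Residual.IsRationalLine W 3 Φ ∧ ∀ (v : IsDedekindDomain.HeightOneSpectrum (NumberField.RingOfIntegers ℚ)), ((3 : ℕ) : NumberField.RingOfIntegers ℚ) ∈ v.asIdeal → ∀ 𝔓 ∈ v.primesAbove, ¬ (∀ g ∈ 𝔓.decompositionSubgroup (Field.absoluteGaloisGroup ℚ), ∀ P ∈ Φ, g • P = P) ∧ ¬ (∀ g ∈ 𝔓.decompositionSubgroup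 (Field.absoluteGaloisGroup ℚ), ∀ P : WeierstrassCurve.geomTorsion W ((3 : ℕ) : ℤ), g • P - P ∈ Φ)) → W.analyticRank = 1 → W.conductorNorm ℤ = N → Literature.NumberTheory.EllipticCurves.IsImaginaryQuadratic K → Literature.NumberTheory.EllipticCurves.SatisfiesHeegnerHypothesis N K → ∀ (κ : Literature.NumberTheory.EllipticCurves.ZpExtension K 3), κ.IsAnticyclotomic → ∀ (γ : Field.absoluteGaloisGroup K) [Fact (κ.IsTopGenerator γ)] (𝔭 : IsDedekindDomain.HeightOneSpectrum (NumberField.RingOfIntegers K)), ((3 : ℕ) : NumberField.RingOfIntegers K) ∈ 𝔭.asIdeal → 𝔭.asIdeal.ramificationIdx (NumberField.RingOfIntegers ℚ) = 1 → 𝔭.asIdeal.inertiaDeg (NumberField.RingOfIntegers ℚ) = 1 → ∀ (𝔭' : IsDedekindDomain.HeightOneSpectrum (NumberField.RingOfIntegers K)), ((3 : ℕ) : NumberField.RingOfIntegers K) ∈ 𝔭'.asIdeal → 𝔭' ≠ 𝔭 → ∀ (ι' : PadicAlgCl 3 ≃+* ℂ), Summit.BirchSwinnertonDyer.BirchSwinnertonDyer.Theorems.SchneiderFree.BranchInducesPrime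 3 ι' 𝔭 → ∀ (ΩK : ℂ) (Ωp : ℂ_[3]) (L : Literature.NumberTheory.EllipticCurves.UnrSeries 3), ΩK ≠ 0 → Ωp ≠ 0 → Literature.NumberTheory.EllipticCurves.IsBDPLFunction ι' 𝔭 κ γ Dt.f ΩK Ωp L → ∃ μ : ℕ, Ideal.span {(3 : Literature.NumberTheory.EllipticCurves.UnrSeries 3) ^ μ * L} ≤ (Summit.BirchSwinnertonDyer.Rank1Residual.X11b.AcSelmer.XAc.charIdeal (W.baseChange K) 3 κ 𝔭' ∅ γ).map (PowerSeries.map (Summit.BirchSwinnertonDyer.Rank1Residual.X11b.Halves.toUnr 3)) :=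
  Summit.BirchSwinnertonDyer.BirchSwinnertonDyer.Theorems.TemperedHeegnerInclusionAtThreeLocalTypeSplitDoors.temperedHeegnerInclusionAtThree_typeGNine_of_temperedIndexBound
    hIB

end Summit.BirchSwinnertonDyer.BirchSwinnertonDyer.Cruxes.TemperedHeegnerInclusionAtThree.Untwist

end
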